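import Summits.ABC.ABC.Theses.CubicResolventAllowance
import Literature.NumberTheory.DiophantineGeometry.MinimalDiscriminantProofs
import Literature.NumberTheory.DiophantineGeometry.Conductor
import HarnessLib

/-!
# Route CubicResolventAllowance — item `ResolventPayoff` (stmt-ABC-22744)

`resolventPayoff_proof : IndexSzpiro → QuadraticIndexSzpiro → SplitClassPolySzpiro →
ResolventDiscBounds → ∃ K C, ∀ E/ℚ elliptic, log |Δ_min(E)| ≤ K · log N_E + C`.

The four hypotheses are the route's two index cruxes (Szpiro with the resolvent-field discriminant
as an allowance on the cubic-field class `r = 0` and on the quadratic class `r = 1`), the declared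
split-class complement (`r = 3`) and the resolvent discriminant bounds `|d_K| ≤ 1944 · N²`,
`|d_{K₂}| ≤ 8 · N`. The conclusion is polynomial Szpiro for **all** `E/ℚ` (the A-PS rung, inlined in
the route file) with exponent `max 9 K_split`. A-PS is NOT abc («NOT abc — POLY-SZPIRO(E)»); this
file proves an implication between typed statements, no conjecture.

## Proof

* `cubic_trichotomy`: a polynomial of degree `3` over a field either has three roots counted with
  multiplicity (`f.roots = {x, y, z}`), or is irreducible (no root), or has an irreducible quadratic
  factor (exactly one root); two roots are impossible because the cofactor of
  `∏ (X - root)` has no roots (`Polynomial.exists_prod_multiset_X_sub_C_mul`) and a linear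
  polynomial over a field has one.
* `exists_numberField_root`: for an irreducible `g ∣ f` of degree `≥ 2` over `ℚ`, the number field
  `K := AdjoinRoot g` has `finrank ℚ K = deg g` (`AdjoinRoot.powerBasis`) and contains a root of `f`
  that is not rational (an irreducible polynomial of degree `2` or `3` has no root). All `ℚ`-module /
  `ℚ`-algebra structures on a field agree (`subsingleton_rat_module`, `algebra_rat_subsingleton`),
  which transports the `AdjoinRoot` algebra structure to the canonical one of the route statement.
* bookkeeping at `ε := 1`: `|Δ_min| ≤ C·|d_K|·N⁷` and `|d_K| ≤ A·Nᵃ` give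
  `log |Δ_min| ≤ (7 + a) log N + log (A · max C 1)` (`log_le_of_index_bound`; `|Δ_min| ≥ 1` and
  `N ≥ 1` by `minimalDiscriminantNorm_pos_holds`, `conductorNorm_pos_holds`), so
  `K := max 9 K_split` and `C := max (max (log (1944 · max C₁ 1)) (log (8 · max C₂ 1))) C_split`.

Elementary; no named facts; standard axioms. Sources: the trichotomy of the 2-division cubic is
Silverman, AEC (2009) III.1 / VIII.8 bookkeeping; the line is the ideator's card of route
`CubicResolventAllowance` (abc-idea-2).
-/

-- `Summit.<Summit>.<Problem>` is the mandated summit-side namespace (CONVENTIONS §2); for the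
-- single-conjunct summit `ABC` the two coincide, so the duplicate `ABC.ABC` is deliberate.
set_option linter.dupNamespace false

namespace Summit.ABC.ABC.Theorems

open Polynomial
open Summit.ABC.ABC.Theses.CubicResolventAllowance

/-! ### Trichotomy of a cubic over a field -/

/-- A polynomial of degree `3` over a field has three roots with multiplicity, or is irreducible,
or has an irreducible quadratic factor (the case of exactly one root; two roots are impossible).
[folklore] -/
theorem cubic_trichotomy {F : Type*} [Field F] {f : F[X]} (hf : f.natDegree = 3) :
    (∃ x y z : F, f.roots = {x, y, z}) ∨ Irreducible f ∨
      ∃ g : F[X], Irreducible g ∧ g.natDegree = 2 ∧ g ∣ f := by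
  obtain ⟨q, hprod, hcard, hq⟩ := f.exists_prod_multiset_X_sub_C_mul
  rw [hf] at hcard
  rcases Nat.lt_or_ge (Multiset.card f.roots) 1 with h0 | h1
  · -- no root: `f` is irreducible
    refine Or.inr (Or.inl ?_)
    have hr : f.roots = 0 := Multiset.card_eq_zero.mp (by omega)
    exact (Polynomial.irreducible_iff_roots_eq_zero_of_degree_le_three (by omega) (by omega)).mpr hr
  rcases Nat.lt_or_ge (Multiset.card f.roots) 2 with h1' | h2
  · -- exactly one root: the cofactor `q` is an irreducible quadratic
    refine Or.inr (Or.inr ⟨q, ?_, by omega, Dvd.intro_left _ hprod⟩)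
    exact (Polynomial.irreducible_iff_roots_eq_zero_of_degree_le_three (by omega) (by omega)).mpr hq
  rcases Nat.lt_or_ge (Multiset.card f.roots) 3 with h2' | h3
  · -- exactly two roots: the linear cofactor would have a root
    exfalso
    have hq1 : q.natDegree = 1 := by omega
    have hq0 : q ≠ 0 := by
      rintro rfl
      simp at hq1
    obtain ⟨x, hx⟩ := Polynomial.exists_root_of_degree_eq_one
      ((Polynomial.degree_eq_iff_natDegree_eq_of_pos Nat.one_pos).mpr hq1)
    have hmem : x ∈ q.roots := (Polynomial.mem_roots hq0).mpr hx
    rw [hq] at hmem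
    exact Multiset.notMem_zero _ hmem
  · exact Or.inl (Multiset.card_eq_three.mp (by omega))

/-! ### Number fields generated by a root -/

/-- `Polynomial.aeval` does not depend on the `ℚ`-algebra structure (there is only one).
[folklore] -/
theorem aeval_rat_eq_of_algebra {K : Type*} [CommRing K] (i₁ i₂ : Algebra ℚ K) (θ : K) (p : ℚ[X]) :
    @Polynomial.aeval ℚ K _ _ i₁ θ p = @Polynomial.aeval ℚ K _ _ i₂ θ p := by
  obtain rfl : i₁ = i₂ := Subsingleton.elim _ _
  rfl

/-- `algebraMap ℚ K` does not depend on the `ℚ`-algebra structure (there is only one). [folklore] -/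
theorem algebraMap_rat_eq_of_algebra {K : Type*} [CommRing K] (i₁ i₂ : Algebra ℚ K) (q : ℚ) :
    @algebraMap ℚ K _ _ i₁ q = @algebraMap ℚ K _ _ i₂ q := by
  obtain rfl : i₁ = i₂ := Subsingleton.elim _ _
  rfl

/-- For an irreducible `g ∣ f` over `ℚ` of degree `2` or `3`, the number field `ℚ[X]/(g)` has
degree `deg g` and contains an irrational root of `f`. [folklore] -/
theorem exists_numberField_root {f g : ℚ[X]} (hg : Irreducible g) (h2 : 2 ≤ g.natDegree)
    (h3 : g.natDegree ≤ 3) (hgf : g ∣ f) :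
    ∃ (K : Type) (_ : Field K) (_ : NumberField K), Module.finrank ℚ K = g.natDegree ∧
      ∃ θ : K, Polynomial.aeval θ f = 0 ∧ ∀ q : ℚ, θ ≠ algebraMap ℚ K q := by
  haveI : Fact (Irreducible g) := ⟨hg⟩
  refine ⟨AdjoinRoot g, inferInstance, inferInstance, ?_, AdjoinRoot.root g, ?_, ?_⟩
  · -- `finrank` over the `AdjoinRoot` module structure; `Module ℚ K` is a subsingleton
    -- (`subsingleton_rat_module`, cf. the tree's `finrank_rat_eq_finrank_rat`), so `convert` closes
    -- the transport to the canonical structure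
    have h := (AdjoinRoot.powerBasis hg.ne_zero).finrank
    rw [AdjoinRoot.powerBasis_dim] at h
    convert h using 2
  · -- computed in the `AdjoinRoot` algebra structure, then transported
    obtain ⟨r, rfl⟩ := hgf
    have h := (AdjoinRoot.aeval_eq (f := g) (g * r)).trans
      (show AdjoinRoot.mk g (g * r) = 0 by rw [map_mul, AdjoinRoot.mk_self, zero_mul])
    exact (aeval_rat_eq_of_algebra _ _ _ _).trans h
  · intro q hq
    have hq' : AdjoinRoot.root g = AdjoinRoot.of g q := by
      rw [hq, ← AdjoinRoot.algebraMap_eq]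
      exact algebraMap_rat_eq_of_algebra _ _ q
    have h0 := AdjoinRoot.eval₂_root g
    rw [hq', Polynomial.eval₂_hom, map_eq_zero] at h0
    have hr : g.roots = 0 :=
      (Polynomial.irreducible_iff_roots_eq_zero_of_degree_le_three h2 h3).mp hg
    have hmem : q ∈ g.roots := (Polynomial.mem_roots hg.ne_zero).mpr h0
    rw [hr] at hmem
    exact Multiset.notMem_zero _ hmem

/-! ### Bookkeeping at `ε = 1` -/

/-- From `Δ ≤ C · d · N^(6+1)` and `d ≤ A · Nᵃ` (with `Δ, N ≥ 1`, `d ≥ 0`, `A > 0`):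
`log Δ ≤ (7 + a) · log N + log (A · max C 1)`. [folklore] -/
theorem log_le_of_index_bound {Δ N d C A : ℝ} {a : ℕ} (hΔ : 1 ≤ Δ) (hN : 1 ≤ N) (hd : 0 ≤ d)
    (hA : 0 < A) (h : Δ ≤ C * d * N ^ ((6 : ℝ) + 1)) (hdA : d ≤ A * N ^ a) :
    Real.log Δ ≤ ((7 + a : ℕ) : ℝ) * Real.log N + Real.log (A * max C 1) := by
  have h7 : N ^ ((6 : ℝ) + 1) = N ^ (7 : ℕ) := by
    rw [show (6 : ℝ) + 1 = ((7 : ℕ) : ℝ) by norm_num, Real.rpow_natCast]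
  rw [h7] at h
  have hN0 : 0 ≤ N := by linarith
  have hC : C ≤ max C 1 := le_max_left _ _
  have hM : 0 ≤ max C 1 := le_trans zero_le_one (le_max_right _ _)
  have key : Δ ≤ A * max C 1 * N ^ (7 + a) := by
    calc Δ ≤ C * d * N ^ 7 := h
      _ ≤ max C 1 * d * N ^ 7 :=
          mul_le_mul_of_nonneg_right (mul_le_mul_of_nonneg_right hC hd) (pow_nonneg hN0 7)
      _ ≤ max C 1 * (A * N ^ a) * N ^ 7 :=
          mul_le_mul_of_nonneg_right (mul_le_mul_of_nonneg_left hdA hM) (pow_nonneg hN0 7)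
      _ = A * max C 1 * N ^ (7 + a) := by ring
  have hpos : 0 < A * max C 1 := mul_pos hA (lt_of_lt_of_le zero_lt_one (le_max_right _ _))
  calc Real.log Δ ≤ Real.log (A * max C 1 * N ^ (7 + a)) :=
        Real.log_le_log (by linarith) key
    _ = Real.log (A * max C 1) + ((7 + a : ℕ) : ℝ) * Real.log N := by
        rw [Real.log_mul hpos.ne' (pow_pos (by linarith) _).ne', Real.log_pow]
    _ = _ := by ring

/-- Enlarging slope and constant: `x ≤ K₀ L + C₀`, `K₀ ≤ K`, `C₀ ≤ C`, `L ≥ 0` give `x ≤ K L + C`.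
[folklore] -/
theorem le_of_slope_const_le {x L K₀ C₀ K C : ℝ} (hL : 0 ≤ L) (h : x ≤ K₀ * L + C₀)
    (hK : K₀ ≤ K) (hC : C₀ ≤ C) : x ≤ K * L + C := by
  have := mul_le_mul_of_nonneg_right hK hL
  linarith

/-! ### The payoff -/

/-- **Item `ResolventPayoff` (stmt-ABC-22744) of route CubicResolventAllowance.** The two index
cruxes, the declared split-class complement and the resolvent discriminant bounds give polynomial
Szpiro for every elliptic curve over `ℚ`: `log |Δ_min| ≤ K log N + C` with `K = max 9 K_split`.
Proof: trichotomy on the number of rational roots of the 2-division cubic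
`4x³ + b₂x² + 2b₄x + b₆` (`cubic_trichotomy`), the number field `ℚ[X]/(g)` of the irreducible
cubic resp. quadratic factor (`exists_numberField_root`), and `ε := 1` bookkeeping
(`log_le_of_index_bound`). A-PS is NOT abc; no conjecture is proved here. [folklore] -/
theorem resolventPayoff_proof : ResolventPayoff := by
  unfold ResolventPayoff IndexSzpiro QuadraticIndexSzpiro SplitClassPolySzpiro ResolventDiscBounds
  intro h₁ h₂ h₃ hd
  obtain ⟨C₁, hC₁⟩ := h₁ 1 one_pos
  obtain ⟨C₂, hC₂⟩ := h₂ 1 one_pos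
  obtain ⟨Ks, Cs, hs⟩ := h₃
  obtain ⟨hd₃, hd₂⟩ := hd
  refine ⟨max 9 Ks, max (max (Real.log (1944 * max C₁ 1)) (Real.log (8 * max C₂ 1))) Cs, ?_⟩
  intro W _
  have hΔ : (1 : ℝ) ≤ (W.minimalDiscriminantNorm ℤ : ℝ) :=
    Nat.one_le_cast.mpr (W.minimalDiscriminantNorm_pos_holds)
  have hN : (1 : ℝ) ≤ (W.conductorNorm ℤ : ℝ) := Nat.one_le_cast.mpr (W.conductorNorm_pos_holds)
  have hlogN : 0 ≤ Real.log (W.conductorNorm ℤ : ℝ) := Real.log_nonneg hN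
  have hdeg : W.twoTorsionPolynomial.toPoly.natDegree = 3 :=
    Cubic.natDegree_of_a_ne_zero (by norm_num [WeierstrassCurve.twoTorsionPolynomial])
  rcases cubic_trichotomy hdeg with ⟨e₁, e₂, e₃, hroots⟩ | hirr | ⟨g, hg, hg2, hgf⟩
  · -- split class
    exact le_of_slope_const_le hlogN (hs W ⟨e₁, e₂, e₃, hroots⟩) (le_max_right _ _)
      (le_max_right _ _)
  · -- irreducible 2-division cubic: cubic field class
    obtain ⟨K, _, _, hfin, θ, hθ, -⟩ := exists_numberField_root hirr (by omega) (by omega) dvd_rfl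
    rw [hdeg] at hfin
    have hb := hC₁ W K hirr hfin ⟨θ, hθ⟩
    have hdisc := hd₃ W K hirr hfin ⟨θ, hθ⟩
    have := log_le_of_index_bound hΔ hN (abs_nonneg _) (by norm_num) hb hdisc
    refine le_of_slope_const_le hlogN this (by norm_num) ?_
    exact le_trans (le_max_left _ _) (le_max_left _ _)
  · -- one rational root: quadratic field class
    obtain ⟨K, _, _, hfin, θ, hθ, hirrat⟩ := exists_numberField_root hg (by omega) (by omega) hgf
    rw [hg2] at hfin
    have hb := hC₂ W K hfin ⟨θ, hθ, hirrat⟩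
    have hdisc := hd₂ W K hfin ⟨θ, hθ, hirrat⟩
    rw [← pow_one (W.conductorNorm ℤ : ℝ)] at hdisc
    have := log_le_of_index_bound hΔ hN (abs_nonneg _) (by norm_num) hb hdisc
    refine le_of_slope_const_le hlogN this (by norm_num) ?_
    exact le_trans (le_max_right _ _) (le_max_left _ _)

end Summit.ABC.ABC.Theorems
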